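import Summits.QuantumFields.YangMills.Theorems.BalabanLadderIRGaugeImageBlindDefs
import Summits.QuantumFields.YangMills.Theorems.BalabanLadderIRFrameCells
import Literature.MathematicalPhysics.QuantumLattice.LatticeGaugeDLRProofs
import HarnessLib

/-!
# Gauge-image blindness of Wilson DLR kernels, I — interior gauge invariance and collar blindness

Count-neutral helper lemmas for crux `stmt-QuantumFields-19354` (`BalabanLadder.IR`), typed by the crux-ideate seat
ym-cruxidea-19354-2 (gen 3, card `orbit-blind-collars-locate-the-row`, `Sketch-g3.lean` sha16 47d20d20eb75f8bf §1–§3,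
evidence #46 on the item; (C1)–(C3) of owner READING R44, «MAY LAND as count-neutral helpers») and landed verbatim up
to the import swap (`Cruxes.IR.Lines.birth` ↦ the Theses-free cell vocabulary `…IRStubRungStrong` ∕ `…IRStubShellRung`
∕ `…IRFrameCells`).  ROUTE-INDEPENDENT (no `Theses` import); gauge covariance is the tree's
`ymSpecification_map_gaugeTransformZd_holds` (imported, not re-proved).

## What is proved here (exact identities every DLR kernel of the Wilson specification satisfies)

* §0 algebra of restricted gauge transformations (`comp_gaugeTransformZd_congr`, `gaugeTransformZd_restrict_eq_off`,
  `gaugeTransformZd_mul_central`, `gaugeTransformZd_twistFn_central`).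
* §1 `integral_gaugeImage_eq` — THE LEVER (interior gauge invariance of a DLR kernel, exact): for an edge set `Λ`
  (resampled), a datum `η`, ANY gauge transformation `g`, and a cylinder `f` of an edge set `E`, if `g = 1` at every
  site that is an endpoint of BOTH an `E`-edge and a frozen edge (`∉ Λ`), then `∫ f dγ_Λ(· | g·η) = ∫ f dγ_Λ(· | η)`.
  Proof: covariance + `f ∘ T_g = f ∘ T_{g|E}` (cylinder) + covariance backwards + `g|E · η = η` off `Λ`
  (`ymSpecification_congr_off`).
* §2 frame geometry: an edge of a cell `c` with some `|c k| ≥ 2` shares no endpoint with a centre-cell edge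
  (`not_touch_of_far`); no edge of a cell off the centre row is a layer link (`layer_not_mem_cell`).
* §3 COLLAR BLINDNESS `integral_gaugeImage_eq_of_collar` (C1): if the resampled cell set `Y` contains the
  `3⁴`-collar `{c : |c|∞ ≤ 1}`, the centre-cell marginal of `γ_Y(·|η)` is a function of the GAUGE ORBIT of `η`.

The one-sided blindness ∕ sandwich ∕ observable-side theorems (C2), (C3) are in
`Theorems/BalabanLadderIRGaugeImageBlindLayer.lean`.  Nothing here refutes or proves `IR`; HONEST FRAMING: kernel
bookkeeping for an OPEN crux of a conditional chain.
-/

noncomputable section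

open MeasureTheory
open Literature.MathematicalPhysics.QuantumFieldTheory Literature.MathematicalPhysics.QuantumLattice
open Literature.Probability.LatticeModels (Site)
open Summit.QuantumFields.YangMills.Cruxes.IR.Tempered (cellEdges regionEdges)
open Summit.QuantumFields.YangMills.Cruxes.IR.ShellTempered (ymSpecification_congr_off)
open Summit.QuantumFields.YangMills.Cruxes.IR.CellTempered.Engine
  (frameIdx frameIdx_eq_iff frameCell mem_cellEdges_frameCell frame_add_nat_le)

namespace Summit.QuantumFields.YangMills.Cruxes.IR.CruxIdea2g3

section Algebra

/-! ## §0 Algebra of restricted and layer gauge transformations -/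

variable {G : Type} [Group G]

/-- A cylinder of `E` sees a gauge transformation only through its values on the sites touched by `E`. -/
theorem comp_gaugeTransformZd_congr {E : Finset Edge} {α : Type*} {f : LGConfig 4 G → α} (hf : IsCylinder f E)
    {g₁ g₂ : Site 4 → G} (h : ∀ x, Touches E x → g₁ x = g₂ x) (U : LGConfig 4 G) :
    f (gaugeTransformZd g₁ U) = f (gaugeTransformZd g₂ U) := by
  apply hf
  intro e he
  have he' : e ∈ E := by simpa using he
  simp only [gaugeTransformZd]
  rw [h _ ⟨e, he', Or.inl rfl⟩, h _ ⟨e, he', Or.inr rfl⟩]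

/-- The restricted transformation fixes the datum on every edge off `Λ`, provided `g = 1` at every site that is an
endpoint of both an `E`-edge and an edge off `Λ`. -/
theorem gaugeTransformZd_restrict_eq_off {E Λ : Finset Edge} {g : Site 4 → G}
    (hg : ∀ e ∉ Λ, ∀ x, IsEndpt e x → Touches E x → g x = 1) (η : LGConfig 4 G) :
    ∀ e ∉ Λ, gaugeTransformZd (restrictGauge E g) η e = η e := by
  classical
  intro e he
  have h1 : restrictGauge E g e.1 = 1 := by
    by_cases ht : Touches E e.1
    · simp [restrictGauge, ht, hg e he _ (Or.inl rfl) ht]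
    · simp [restrictGauge, ht]
  have h2 : restrictGauge E g (e.1 + Pi.single e.2 1) = 1 := by
    by_cases ht : Touches E (e.1 + Pi.single e.2 1)
    · simp [restrictGauge, ht, hg e he _ (Or.inr rfl) ht]
    · simp [restrictGauge, ht]
  simp [gaugeTransformZd, h1, h2]

/-- A global CENTRAL constant acts trivially: `T_{g·c} = T_g` for `c ∈ Z(G)`. -/
theorem gaugeTransformZd_mul_central (g : Site 4 → G) {c : G} (hc : c ∈ Subgroup.center G) :
    gaugeTransformZd (fun x => g x * c) = gaugeTransformZd (G := G) g := by
  have hcz : ∀ u : G, u * c = c * u := Subgroup.mem_center_iff.1 hc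
  funext U e
  simp only [gaugeTransformZd, mul_inv_rev]
  calc g e.1 * c * U e * (c⁻¹ * (g (e.1 + Pi.single e.2 1))⁻¹)
      = g e.1 * (c * U e * c⁻¹) * (g (e.1 + Pi.single e.2 1))⁻¹ := by simp only [mul_assoc]
    _ = g e.1 * U e * (g (e.1 + Pi.single e.2 1))⁻¹ := by rw [← hcz (U e), mul_inv_cancel_right]

/-- For CENTRAL `z` the layer transformation multiplies the layer links by `z⁻¹` and fixes every other edge
(verbatim g2). -/
theorem gaugeTransformZd_twistFn_central {z : G} (hz : z ∈ Subgroup.center G) (t₀ : ℤ) (U : LGConfig 4 G)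
    (e : Edge) : gaugeTransformZd (twistFn t₀ z) U e = if e.2 = 0 ∧ e.1 0 = t₀ then U e * z⁻¹ else U e := by
  have hcz : ∀ g : G, g * z = z * g := Subgroup.mem_center_iff.1 hz
  have hconj : ∀ u : G, z * u * z⁻¹ = u := fun u => by rw [← hcz u, mul_inv_cancel_right]
  obtain ⟨x, i⟩ := e
  simp only [gaugeTransformZd, twistFn, Pi.add_apply]
  by_cases hi : i = 0
  · subst hi
    simp only [Pi.single_eq_same, true_and]
    by_cases hx : x 0 = t₀
    · simp [hx]
    · by_cases hlt : t₀ < x 0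
      · have : t₀ < x 0 + 1 := by omega
        simp [hlt, this, hx, hconj]
      · have : ¬ t₀ < x 0 + 1 := by omega
        simp [hlt, this, hx]
  · have hne : (0 : Fin 4) ≠ i := fun h0 => hi h0.symm
    simp only [Pi.single_eq_of_ne hne, add_zero, hi, false_and, if_false]
    by_cases hlt : t₀ < x 0 <;> simp [hlt, hconj]

end Algebra

section Geometry

/-! ## §2 Frame geometry: far cells do not touch the centre cell; layer links live in the centre row -/

/-- Coordinates of an endpoint of an edge of cell `c` lie in the CLOSED coordinate ranges of the cell. -/
theorem endpt_coord {w : Fin 4 → ℤ → ℤ} {c : Fin 4 → ℤ} {e : Edge} (he : e ∈ cellEdges w c) {x : Site 4}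
    (hx : IsEndpt e x) (k : Fin 4) : w k (c k) ≤ x k ∧ x k ≤ w k (c k + 1) := by
  simp only [Summit.QuantumFields.YangMills.Cruxes.IR.Tempered.cellEdges, Finset.mem_product,
    Fintype.mem_piFinset, Finset.mem_Ico, Finset.mem_univ, and_true] at he
  have hk := he k
  rcases hx with rfl | rfl
  · exact ⟨hk.1, hk.2.le⟩
  · simp only [Pi.add_apply, Pi.single_apply]
    split_ifs <;> omega

/-- Monotonicity of a frame sequence in quantitative form. -/
theorem frame_le_of_le {f : ℤ → ℤ} (hf : ∀ j, f j + 1 ≤ f (j + 1)) {i j : ℤ} (hij : i ≤ j) :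
    f i + (j - i) ≤ f j := by
  have h := frame_add_nat_le hf i (j - i).toNat
  rw [Int.toNat_of_nonneg (by omega)] at h
  have : i + (j - i) = j := by ring
  rwa [this] at h

/-- A mesh-`b` frame (`b ≥ 1`) is a frame in the engine's sense (`w i j + 1 ≤ w i (j+1)`). -/
theorem frame_one_of_mesh {b : ℕ} (hb : 1 ≤ b) {w : Fin 4 → ℤ → ℤ}
    (hw : ∀ i j, w i j + ((b : ℕ) : ℤ) ≤ w i (j + 1) ∧ w i (j + 1) ≤ w i j + 2 * ((b : ℕ) : ℤ)) :
    ∀ i j, w i j + 1 ≤ w i (j + 1) := fun i j => by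
  have := (hw i j).1
  have hb' : (1 : ℤ) ≤ ((b : ℕ) : ℤ) := by exact_mod_cast hb
  linarith

/-- **Far cells do not touch the centre cell.**  An edge of a cell `c` with some `|c k| ≥ 2` shares no endpoint with
an edge of the centre cell `0` (cells have width `≥ 1`). -/
theorem not_touch_of_far {w : Fin 4 → ℤ → ℤ} (hw1 : ∀ i j, w i j + 1 ≤ w i (j + 1))
    {c : Fin 4 → ℤ} {k : Fin 4} (hk : 2 ≤ |c k|)
    {e : Edge} (he : e ∈ cellEdges w c) {e₀ : Edge} (he₀ : e₀ ∈ cellEdges w 0) {x : Site 4}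
    (hx : IsEndpt e x) (hx₀ : IsEndpt e₀ x) : False := by
  have h1 := endpt_coord he hx k
  have h2 := endpt_coord he₀ hx₀ k
  simp only [Pi.zero_apply, zero_add] at h2
  rcases le_abs'.1 hk with hneg | hpos
  · -- `c k ≤ -2`: the cell ends at `w k (c k + 1) ≤ w k (-1) ≤ w k 0 - 1 < x k`
    have h3 := frame_le_of_le (hw1 k) (show c k + 1 ≤ -1 by omega)
    have h4 := hw1 k (-1)
    norm_num at h4
    omega
  · -- `c k ≥ 2`: the cell starts at `w k (c k) ≥ w k 2 ≥ w k 1 + 1 > x k`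
    have h3 := frame_le_of_le (hw1 k) (show (2 : ℤ) ≤ c k by omega)
    have h4 := hw1 k 1
    norm_num at h4
    omega

/-- The cell of a frozen edge is not resampled. -/
theorem frameCell_not_mem {w : Fin 4 → ℤ → ℤ} (hw1 : ∀ i j, w i j + 1 ≤ w i (j + 1))
    {Y : Finset (Fin 4 → ℤ)} {e : Edge} (he : e ∉ regionEdges w Y) : frameCell w e ∉ Y := fun hc =>
  he (Finset.mem_biUnion.2 ⟨frameCell w e, hc, mem_cellEdges_frameCell hw1 e⟩)

/-- No edge of a cell `c` with `c 0 ≠ 0` is a layer link `(x, 0)` with `x 0 = t₀ ∈ [w 0 0, w 0 1)` (verbatim g2). -/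
theorem layer_not_mem_cell {w : Fin 4 → ℤ → ℤ} (hw1 : ∀ i j, w i j + 1 ≤ w i (j + 1))
    {t₀ : ℤ} (ht₀ : w 0 0 ≤ t₀) (ht₁ : t₀ < w 0 1) {c : Fin 4 → ℤ} (hc : c 0 ≠ 0)
    {e : Edge} (he : e ∈ cellEdges w c) : ¬ (e.2 = 0 ∧ e.1 0 = t₀) := by
  intro hcond
  have he0 : w 0 (c 0) ≤ e.1 0 ∧ e.1 0 < w 0 (c 0 + 1) := by
    simp only [Summit.QuantumFields.YangMills.Cruxes.IR.Tempered.cellEdges, Finset.mem_product,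
      Fintype.mem_piFinset, Finset.mem_Ico] at he
    exact he.1 0
  have h1 : frameIdx (w 0) t₀ = c 0 := (frameIdx_eq_iff (hw1 0) t₀ (c 0)).2 (hcond.2 ▸ he0)
  have h2 : frameIdx (w 0) t₀ = 0 := (frameIdx_eq_iff (hw1 0) t₀ 0).2 ⟨ht₀, by simpa using ht₁⟩
  exact hc (h1.symm.trans h2)

end Geometry

section Kernel

variable {G : Type} [Group G] [TopologicalSpace G] [IsTopologicalGroup G] [CompactSpace G]
  [MeasurableSpace G] [BorelSpace G]

/-! ## §1 The lever: interior gauge invariance of a DLR kernel -/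

/-- **INTERIOR GAUGE INVARIANCE (exact).**  If `g = 1` at every site that is an endpoint of both an `E`-edge and a
frozen edge (`∉ Λ`), the kernel `γ_Λ` gives every `E`-cylinder the same expectation under the data `η` and `g·η`.
(`g` itself may be anything elsewhere — in particular far from `E` it may change `η` arbitrarily within its gauge
orbit.) -/
theorem integral_gaugeImage_eq [SecondCountableTopology G] {N : ℕ} (ρ : G →* Matrix (Fin N) (Fin N) ℂ)
    (hρ : Continuous ρ) (β : ℝ) (Λ E : Finset Edge) (g : Site 4 → G) (η : LGConfig 4 G)
    (hg : ∀ e ∉ Λ, ∀ x, IsEndpt e x → Touches E x → g x = 1)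
    (f : LGConfig 4 G → ℝ) (hf : IsCylinder f E) (hfm : Measurable f) :
    ∫ U, f U ∂(ymSpecification ρ β Λ (gaugeTransformZd g η)) = ∫ U, f U ∂(ymSpecification ρ β Λ η) := by
  classical
  have hint : ∀ g' : Site 4 → G, (∫ U, f U ∂(ymSpecification ρ β Λ (gaugeTransformZd g' η))) =
      ∫ U, f (gaugeTransformZd g' U) ∂(ymSpecification ρ β Λ η) := fun g' => by
    rw [← ymSpecification_map_gaugeTransformZd_holds (d := 4) ρ hρ β Λ η g',
      integral_map (measurable_gaugeTransformZd g').aemeasurable hfm.aestronglyMeasurable]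
  have h1 : ∀ U, f (gaugeTransformZd g U) = f (gaugeTransformZd (restrictGauge E g) U) := fun U =>
    comp_gaugeTransformZd_congr hf (fun x hx => by simp [restrictGauge, hx]) U
  rw [hint g]
  simp_rw [h1]
  rw [← hint (restrictGauge E g)]
  exact congrArg (fun μ => ∫ U, f U ∂μ)
    (ymSpecification_congr_off ρ β Λ (gaugeTransformZd_restrict_eq_off hg η))

/-! ## §3 Collar blindness (C1) -/

/-- **COLLAR BLINDNESS (exact, PROVED).**  If the resampled cell set `Y` contains the `3⁴`-collar of the centre cell
(`every c with |c|∞ ≤ 1`), then for EVERY gauge transformation `g` and EVERY datum `η` the centre-cell cylinders have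
the same expectation under `γ_Y(·|η)` and `γ_Y(·|g·η)`: the centre-cell marginal is a function of the gauge ORBIT of
the data.  (No centrality, no typicality, no window: the collar alone does it.) -/
theorem integral_gaugeImage_eq_of_collar [SecondCountableTopology G] {N : ℕ}
    (ρ : G →* Matrix (Fin N) (Fin N) ℂ) (hρ : Continuous ρ) (β : ℝ) {w : Fin 4 → ℤ → ℤ}
    (hw1 : ∀ i j, w i j + 1 ≤ w i (j + 1)) (Y : Finset (Fin 4 → ℤ))
    (hY : ∀ c : Fin 4 → ℤ, (∀ k, |c k| ≤ 1) → c ∈ Y) (g : Site 4 → G) (η : LGConfig 4 G)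
    (f : LGConfig 4 G → ℝ) (hf : IsCylinder f (cellEdges w 0)) (hfm : Measurable f) :
    ∫ U, f U ∂(ymSpecification ρ β (regionEdges w Y) (gaugeTransformZd g η)) =
      ∫ U, f U ∂(ymSpecification ρ β (regionEdges w Y) η) := by
  refine integral_gaugeImage_eq ρ hρ β _ _ g η (fun e he x hx hx₀ => ?_) f hf hfm
  obtain ⟨e₀, he₀, hx₀⟩ := hx₀
  have hc : frameCell w e ∉ Y := frameCell_not_mem hw1 he
  have hfar : ∃ k, 2 ≤ |frameCell w e k| := by
    by_contra hcon
    push Not at hcon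
    exact hc (hY _ fun k => by have := hcon k; omega)
  obtain ⟨k, hk⟩ := hfar
  exact (not_touch_of_far hw1 hk (mem_cellEdges_frameCell hw1 e) he₀ hx hx₀).elim

end Kernel

end Summit.QuantumFields.YangMills.Cruxes.IR.CruxIdea2g3

end
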